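import Summits.CriticalPhenomena.PercolationContinuityZ3.Theorems.PercNearOneGluingNoHeavyLowerTailSunflowerCloneOps
import HarnessLib

/-!
# `NoHeavyLowerTail` (crux stmt-CriticalPhenomena-4575), abstract sunflower cubic: clone calculus, part 3 — the three-independent-copies
# functional is the cubic form in the cell masses of the product measure

Support file (seat `prim-l12-p2` gen 6; `--supports stmt-CriticalPhenomena-4575`; after `…SunflowerCloneOps`).  No `sorry`, no named facts.
Memo: run/shared/lean/prim/prim-l12/prim-l12-p2/FINDING-g6-COMPOSITION-IDENTITY.md.

For a labelling `lab : 2^E → Fin 5` and `p : E → ℝ` put `wP p S = ∏_x (p x if x ∈ S else 1 − p x)` (the product-measure weight of the configuration `S`,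
all coordinates random — `DecisionTreeWeighted.wtW univ`) and `mass lab p v = Σ_{lab S = v} wP p S` (cell masses).  Then (`Mk_bern_eq_cubic`)
  `Mk κ lab (bern ∘ p) = Σ_{x,y,z : Fin 5} mass x · mass y · mass z · κ x y z`,
the expectation of `κ (lab ω¹) (lab ω²) (lab ω³)` over three INDEPENDENT samples of the product measure — via the transpose equivalence
`blocksEquiv : (E → Pat) ≃ (2^E)³` (pattern assignments = triples of configurations) and `∏_e bern (p e) (β e) = wP(copy 0)·wP(copy 1)·wP(copy 2)`.
With `…SunflowerCloneTransfer`: partition positivity of `κ` on all finite sunflowers ⇒ this cubic form is `≥ 0` under every product measure.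
-/

namespace Summit.CriticalPhenomena.PercolationContinuityZ3.Theorems.SunflowerPartition

open Finset

section Law

variable {E : Type*} [Fintype E] [DecidableEq E]

/-- The product-measure weight of a configuration (every coordinate random). [folklore] -/
def wP (p : E → ℝ) (S : Finset E) : ℝ := ∏ x, if x ∈ S then p x else 1 - p x

/-- The mass of the cell with label `v`. [this work] -/
def mass (lab : Finset E → Fin 5) (p : E → ℝ) (v : Fin 5) : ℝ := ∑ S : Finset E, if lab S = v then wP p S else 0

/-- TRANSPOSE: pattern assignments `E → Bool³` are triples of configurations. [this work] -/
def blocksEquiv : (E → Pat) ≃ Finset E × Finset E × Finset E where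
  toFun β := (blocks β 0, blocks β 1, blocks β 2)
  invFun T := fun e => (decide (e ∈ T.1), decide (e ∈ T.2.1), decide (e ∈ T.2.2))
  left_inv β := by
    funext e
    ext <;> simp
  right_inv T := by
    obtain ⟨S₀, S₁, S₂⟩ := T
    ext x <;> simp [Pat.bit]

/-- The Bernoulli pattern weights multiply to the three product-measure weights of the copies. [this work] -/
theorem prod_bern_eq (p : E → ℝ) (β : E → Pat) :
    ∏ x, bern (p x) (β x) = wP p (blocks β 0) * (wP p (blocks β 1) * wP p (blocks β 2)) := by
  unfold bern wP
  rw [prod_mul_distrib, prod_mul_distrib]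
  have h0 : ∀ x, (if (β x).1 = true then p x else 1 - p x) = if x ∈ blocks β 0 then p x else 1 - p x := fun x => by simp
  have h1 : ∀ x, (if (β x).2.1 = true then p x else 1 - p x) = if x ∈ blocks β 1 then p x else 1 - p x := fun x => by simp
  have h2 : ∀ x, (if (β x).2.2 = true then p x else 1 - p x) = if x ∈ blocks β 2 then p x else 1 - p x := fun x => by simp
  simp_rw [h0, h1, h2]

/-- `Mk` with Bernoulli weights as a sum over triples of configurations. [this work] -/
theorem Mk_bern_eq_triple (κ : Fin 5 → Fin 5 → Fin 5 → ℝ) (lab : Finset E → Fin 5) (p : E → ℝ) :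
    Mk κ lab (fun x => bern (p x)) =
      ∑ S₀ : Finset E, ∑ S₁ : Finset E, ∑ S₂ : Finset E, wP p S₀ * wP p S₁ * wP p S₂ * κ (lab S₀) (lab S₁) (lab S₂) := by
  unfold Mk
  rw [Fintype.sum_equiv blocksEquiv _
    (fun T : Finset E × Finset E × Finset E => wP p T.1 * wP p T.2.1 * wP p T.2.2 * κ (lab T.1) (lab T.2.1) (lab T.2.2)) ?_]
  · rw [Fintype.sum_prod_type]
    refine sum_congr rfl fun S₀ _ => ?_
    rw [Fintype.sum_prod_type]
  · intro β
    rw [prod_bern_eq]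
    simp only [blocksEquiv, Equiv.coe_fn_mk]
    ring

/-- Grouping a weighted sum over configurations by label. [this work] -/
theorem sum_wP_lab (lab : Finset E → Fin 5) (p : E → ℝ) (g : Fin 5 → ℝ) :
    ∑ S : Finset E, wP p S * g (lab S) = ∑ v : Fin 5, mass lab p v * g v := by
  unfold mass
  simp_rw [sum_mul]
  rw [sum_comm]
  refine sum_congr rfl fun S _ => ?_
  simp_rw [ite_mul, zero_mul]
  rw [sum_ite_eq]
  simp

/-- **The three-independent-copies functional is the cubic form in the cell masses.** [this work] -/
theorem Mk_bern_eq_cubic (κ : Fin 5 → Fin 5 → Fin 5 → ℝ) (lab : Finset E → Fin 5) (p : E → ℝ) :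
    Mk κ lab (fun x => bern (p x)) =
      ∑ x : Fin 5, ∑ y : Fin 5, ∑ z : Fin 5, mass lab p x * mass lab p y * mass lab p z * κ x y z := by
  rw [Mk_bern_eq_triple]
  -- group S₂ by its label
  have h3 : ∀ S₀ S₁ : Finset E, ∑ S₂ : Finset E, wP p S₀ * wP p S₁ * wP p S₂ * κ (lab S₀) (lab S₁) (lab S₂) =
      ∑ z : Fin 5, wP p S₀ * wP p S₁ * mass lab p z * κ (lab S₀) (lab S₁) z := by
    intro S₀ S₁
    have h := sum_wP_lab lab p (fun z => wP p S₀ * wP p S₁ * κ (lab S₀) (lab S₁) z)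
    calc _ = ∑ S₂ : Finset E, wP p S₂ * (wP p S₀ * wP p S₁ * κ (lab S₀) (lab S₁) (lab S₂)) :=
          sum_congr rfl fun _ _ => by ring
      _ = _ := by rw [h]; exact sum_congr rfl fun _ _ => by ring
  simp_rw [h3]
  -- group S₁ by its label
  have h2 : ∀ (S₀ : Finset E) (z : Fin 5), ∑ S₁ : Finset E, wP p S₀ * wP p S₁ * mass lab p z * κ (lab S₀) (lab S₁) z =
      ∑ y : Fin 5, wP p S₀ * mass lab p y * mass lab p z * κ (lab S₀) y z := by
    intro S₀ z
    have h := sum_wP_lab lab p (fun y => wP p S₀ * mass lab p z * κ (lab S₀) y z)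
    calc _ = ∑ S₁ : Finset E, wP p S₁ * (wP p S₀ * mass lab p z * κ (lab S₀) (lab S₁) z) :=
          sum_congr rfl fun _ _ => by ring
      _ = _ := by rw [h]; exact sum_congr rfl fun _ _ => by ring
  have h2' : ∀ S₀ : Finset E, ∑ S₁ : Finset E, ∑ z : Fin 5, wP p S₀ * wP p S₁ * mass lab p z * κ (lab S₀) (lab S₁) z =
      ∑ z : Fin 5, ∑ y : Fin 5, wP p S₀ * mass lab p y * mass lab p z * κ (lab S₀) y z := by
    intro S₀
    rw [sum_comm]
    exact sum_congr rfl fun z _ => h2 S₀ z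
  simp_rw [h2']
  -- group S₀ by its label
  have h1 : ∀ z y : Fin 5, ∑ S₀ : Finset E, wP p S₀ * mass lab p y * mass lab p z * κ (lab S₀) y z =
      ∑ x : Fin 5, mass lab p x * mass lab p y * mass lab p z * κ x y z := by
    intro z y
    have h := sum_wP_lab lab p (fun x => mass lab p y * mass lab p z * κ x y z)
    calc _ = ∑ S₀ : Finset E, wP p S₀ * (mass lab p y * mass lab p z * κ (lab S₀) y z) :=
          sum_congr rfl fun _ _ => by ring
      _ = _ := by rw [h]; exact sum_congr rfl fun _ _ => by ring
  rw [sum_comm]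
  have h1' : ∀ z : Fin 5, ∑ S₀ : Finset E, ∑ y : Fin 5, wP p S₀ * mass lab p y * mass lab p z * κ (lab S₀) y z =
      ∑ y : Fin 5, ∑ x : Fin 5, mass lab p x * mass lab p y * mass lab p z * κ x y z := by
    intro z
    rw [sum_comm]
    exact sum_congr rfl fun y _ => h1 z y
  simp_rw [h1']
  -- reorder (z, y, x) into (x, y, z)
  refine Eq.trans (sum_congr rfl fun z _ => sum_comm) ?_
  rw [sum_comm]
  exact sum_congr rfl fun x _ => sum_comm

end Law

end Summit.CriticalPhenomena.PercolationContinuityZ3.Theorems.SunflowerPartition
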